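import Summits.BirchSwinnertonDyer.BirchSwinnertonDyer.Theses.LeadingTerm
import Summits.BirchSwinnertonDyer.BirchSwinnertonDyer.Theses.Squeeze
import Summits.BirchSwinnertonDyer.BirchSwinnertonDyer.Theses.HigherGrossZagier
import Summits.BirchSwinnertonDyer.BirchSwinnertonDyer.Theorems.LeadingTermSqueezeUBR2StubTransport
import Summits.BirchSwinnertonDyer.BirchSwinnertonDyer.Theorems.LeadingTermSqueezeUBR2Cells
import Summits.BirchSwinnertonDyer.BirchSwinnertonDyer.Theorems.LeadingTermSqueezeUBR2Pinch
import Literature.NumberTheory.EllipticCurves.KatoRankBound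
import HarnessLib

/-!
# BirchSwinnertonDyer — crux `SqueezeUB` / `SqueezeUBR2` (stmt-BirchSwinnertonDyer-0145),
# line `Sketch`, skeleton v3: the crux is EXACTLY three cells — GZK ∧ PAR ∧ UBE4

Crux (`Squeeze.SqueezeUB` = `HigherGrossZagier.SqueezeUB` = `LeadingTerm.SqueezeUBR2`,
byte-identical): **no excess rank**, `rank_ℤ E(ℚ) ≤ ord_{s=1} L(E,s)` for every elliptic `E/ℚ`.

Skeleton v2 (lead -0, `squeezeUB_iff_cells`, p131767) cut the crux along `r_an ≤ 1` / `2 ≤ r_an`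
into GZK ∧ UB3. Skeleton v3 (lead c1) cuts the open cell UB3 along PARITY into its two exact
halves, so that the registered stubs are the three cells of the `(rank, r_an)` table that have
three different literatures:

* GZK-cell `r_an ≤ 1 → rank ≤ r_an` — a theorem in print (Gross–Zagier–Kolyvagin; tree fact
  `rank_eq_analyticRank_of_analyticRank_le_one`, undischarged);
* PAR-cell `2 ≤ r_an → rank ≢ r_an (mod 2) → rank ≤ r_an` — "no excess of ODD size", cells
  `(3,2), (4,3), (5,2), …`: immediate from Mordell–Weil parity, which is route Squeeze's crux
  `SqueezeParity` (open at MW level; a theorem at Selmer level, Dokchitser–Dokchitser 2010) and,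
  inside route LeadingTerm, a consequence of `PinchPrime` + Kato 18.4 + `p`-parity
  (`squeezeUB_parity_of_pinchPrime`, p131867);
* UBE4-cell `4 ≤ rank → 2 ≤ r_an → rank ≡ r_an (mod 2) → rank ≤ r_an` — "no positive EVEN
  excess above four points", cells `(4,2), (5,3), (6,2), (6,4), …`: the PARITY-BLIND core, open,
  no mechanism in print; first cell "`w = +1`, `L(E,1) = 0`, four independent points ⇒
  `L''(E,1) = 0`".

Theorems: `squeezeUB_iff_threeCells` (exactness, unconditional: the floor below rank `4` needs NO
parity — rank `3` with matching parity and `r_an ≥ 2` forces `r_an ≥ 3`), `squeezeUB_ub3_iff_par3_and_ube4`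
(the v2 open cell UB3 is exactly PAR3 ∧ UBE4), `squeezeUB_par_of_parity` / `squeezeUB_par_of_squeezeParity`
(PAR ⇐ MW parity ⇐ `SqueezeParity`), `squeezeUB_of_squeezeParity_of_gzk_of_ube4` (crux ⇐ `SqueezeParity` ∧
GZK ∧ UBE4) and the route-internal form `squeezeUBR2_of_pinchPrime_of_ube4` (in LeadingTerm, whose
`closes` already carries `PinchPrime`, the crux ⇐ Kato corank fact ∧ `p`-parity fact ∧ `PinchPrime`
∧ GZK ∧ UBE4 — the route's UB-hypothesis is, net of print theorems and its own pinch, exactly the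
parity-blind core). Everything here is glue (bookkeeping in `ℕ`); nothing closes the crux.

References: Kato, Astérisque 295 (2004), Thm 18.4; Dokchitser–Dokchitser, Ann. of Math. 172
(2010), Thm 1.4; Darmon, CBMS 101 (2004), Thm 3.22.
-/

set_option linter.dupNamespace false

namespace Summit.BirchSwinnertonDyer.BirchSwinnertonDyer.Theorems

open scoped MatrixGroups ModularForm
open CongruenceSubgroup Literature.NumberTheory.EllipticCurves
  Literature.NumberTheory.EllipticCurves.ModularForms WeierstrassCurve
open Summit.BirchSwinnertonDyer.BirchSwinnertonDyer.Theses.Squeeze (SqueezeUB SqueezeParity)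
open Summit.BirchSwinnertonDyer.BirchSwinnertonDyer.Theses.LeadingTerm (SqueezeUBR2 PinchPrime)

/-! ### Exactness: the crux is GZK ∧ PAR ∧ UBE4 -/

/-- **What the crux is, exactly (v3).** `SqueezeUB` is EQUIVALENT to the conjunction of three
cells on globally minimal models: (GZK) `r_an ≤ 1 → rank ≤ r_an` (Gross–Zagier–Kolyvagin, a
theorem in print), (PAR) `2 ≤ r_an → rank ≢ r_an (mod 2) → rank ≤ r_an` (no odd excess; ⇐
Mordell–Weil parity) and (UBE4) `4 ≤ rank → 2 ≤ r_an → rank ≡ r_an (mod 2) → rank ≤ r_an` (no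
positive even excess above four points; the open parity-blind core). `→` is restriction; `←` is
the parity-free floor (`rank ≤ 3`, `rank ≡ r_an (mod 2)`, `2 ≤ r_an` ⇒ `rank ≤ r_an`) plus
transport along a global minimal model (landed stub TR). Unconditional. [folklore] -/
theorem squeezeUB_iff_threeCells :
    SqueezeUB ↔
      ((∀ (W : WeierstrassCurve ℚ) [W.IsElliptic] [W.IsGloballyMinimal],
          W.analyticRank ≤ 1 → W.mordellWeilRank ≤ W.analyticRank) ∧
        (∀ (W : WeierstrassCurve ℚ) [W.IsElliptic] [W.IsGloballyMinimal],
          2 ≤ W.analyticRank → W.mordellWeilRank % 2 ≠ W.analyticRank % 2 →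
            W.mordellWeilRank ≤ W.analyticRank) ∧
        ∀ (W : WeierstrassCurve ℚ) [W.IsElliptic] [W.IsGloballyMinimal],
          4 ≤ W.mordellWeilRank → 2 ≤ W.analyticRank →
            W.mordellWeilRank % 2 = W.analyticRank % 2 →
              W.mordellWeilRank ≤ W.analyticRank) := by
  constructor
  · intro h
    exact ⟨fun W _ _ _ => h W, fun W _ _ _ _ => h W, fun W _ _ _ _ _ => h W⟩
  · rintro ⟨hGZK, hPAR, hUBE⟩
    refine squeezeUB_of_isGloballyMinimal (fun W _ _ => ?_)
    by_cases h : W.analyticRank ≤ 1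
    · exact hGZK W h
    · by_cases hp : W.mordellWeilRank % 2 = W.analyticRank % 2
      · by_cases h4 : 4 ≤ W.mordellWeilRank
        · exact hUBE W h4 (by omega) hp
        · omega
      · exact hPAR W (by omega) hp

/-- **The v2 open cell UB3 is exactly PAR3 ∧ UBE4**: on globally minimal models,
`3 ≤ rank → 2 ≤ r_an → rank ≤ r_an` holds iff it holds separately for curves whose rank and
analytic rank have opposite parity (PAR3: no odd excess above three points) and for curves of
rank `≥ 4` with matching parity (UBE4) — the only matching-parity configuration with `rank = 3`
and `2 ≤ r_an < 3` would be `r_an = 2`, of the wrong parity. Unconditional. [folklore] -/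
theorem squeezeUB_ub3_iff_par3_and_ube4 :
    (∀ (W : WeierstrassCurve ℚ) [W.IsElliptic] [W.IsGloballyMinimal],
        3 ≤ W.mordellWeilRank → 2 ≤ W.analyticRank → W.mordellWeilRank ≤ W.analyticRank) ↔
      ((∀ (W : WeierstrassCurve ℚ) [W.IsElliptic] [W.IsGloballyMinimal],
          3 ≤ W.mordellWeilRank → 2 ≤ W.analyticRank →
            W.mordellWeilRank % 2 ≠ W.analyticRank % 2 → W.mordellWeilRank ≤ W.analyticRank) ∧
        ∀ (W : WeierstrassCurve ℚ) [W.IsElliptic] [W.IsGloballyMinimal],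
          4 ≤ W.mordellWeilRank → 2 ≤ W.analyticRank →
            W.mordellWeilRank % 2 = W.analyticRank % 2 →
              W.mordellWeilRank ≤ W.analyticRank) := by
  constructor
  · intro h
    exact ⟨fun W _ _ h3 h2 _ => h W h3 h2, fun W _ _ h4 h2 _ => h W (by omega) h2⟩
  · rintro ⟨hPAR, hUBE⟩ W _ _ h3 h2
    by_cases hp : W.mordellWeilRank % 2 = W.analyticRank % 2
    · by_cases h4 : 4 ≤ W.mordellWeilRank
      · exact hUBE W h4 h2 hp
      · omega
    · exact hPAR W h3 h2 hp

/-! ### The parity cell PAR from Mordell–Weil parity -/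

/-- **PAR from Mordell–Weil parity** on globally minimal models (`Even rank ↔ Even r_an`): a curve
whose rank and analytic rank have opposite parity does not exist, so the PAR-cell holds
vacuously. Unconditional implication. [folklore] -/
theorem squeezeUB_par_of_parity
    (hpar : ∀ (W : WeierstrassCurve ℚ) [W.IsElliptic] [W.IsGloballyMinimal],
      Even W.mordellWeilRank ↔ Even W.analyticRank) :
    ∀ (W : WeierstrassCurve ℚ) [W.IsElliptic] [W.IsGloballyMinimal],
      2 ≤ W.analyticRank → W.mordellWeilRank % 2 ≠ W.analyticRank % 2 →
        W.mordellWeilRank ≤ W.analyticRank := by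
  intro W _ _ _ hne
  exfalso
  apply hne
  have h := hpar W
  rw [Nat.even_iff, Nat.even_iff] at h
  rcases Nat.mod_two_eq_zero_or_one W.mordellWeilRank with h0 | h1
  · rw [h0, eq_comm]
    exact h.mp h0
  · rcases Nat.mod_two_eq_zero_or_one W.analyticRank with ha | ha
    · exact absurd (h.mpr ha) (by rw [h1]; decide)
    · rw [h1, ha]

/-- Route Squeeze's crux `SqueezeParity` (stmt-0146; Mordell–Weil parity for every elliptic `E/ℚ`)
gives the PAR-cell. [folklore] -/
theorem squeezeUB_par_of_squeezeParity (hpar : SqueezeParity) :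
    ∀ (W : WeierstrassCurve ℚ) [W.IsElliptic] [W.IsGloballyMinimal],
      2 ≤ W.analyticRank → W.mordellWeilRank % 2 ≠ W.analyticRank % 2 →
        W.mordellWeilRank ≤ W.analyticRank :=
  squeezeUB_par_of_parity (squeezeUB_parity_of_squeezeParity hpar)

/-- **The crux from `SqueezeParity`, GZK and the parity-blind core UBE4** (routes Squeeze /
HigherGrossZagier, where `SqueezeParity` is a sibling item): by exactness and
`squeezeUB_par_of_squeezeParity`. [folklore] -/
theorem squeezeUB_of_squeezeParity_of_gzk_of_ube4 (hpar : SqueezeParity)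
    (hGZK : ∀ (W : WeierstrassCurve ℚ) [W.IsElliptic] [W.IsGloballyMinimal],
      W.analyticRank ≤ 1 → W.mordellWeilRank ≤ W.analyticRank)
    (hUBE : ∀ (W : WeierstrassCurve ℚ) [W.IsElliptic] [W.IsGloballyMinimal],
      4 ≤ W.mordellWeilRank → 2 ≤ W.analyticRank →
        W.mordellWeilRank % 2 = W.analyticRank % 2 → W.mordellWeilRank ≤ W.analyticRank) :
    SqueezeUB :=
  squeezeUB_iff_threeCells.mpr ⟨hGZK, squeezeUB_par_of_squeezeParity hpar, hUBE⟩

/-! ### Inside route LeadingTerm: the UB-hypothesis of `closes` is GZK ∧ UBE4 -/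

/-- **Route-internal form.** In route LeadingTerm, whose deciding theorem
`closes (hC : Consistency) (hP : PinchPrime) (hUB : SqueezeUBR2)` already carries the crux
`PinchPrime` (stmt-16218), the crux `SqueezeUBR2` follows from the ∀-closure of Kato's corank
bound (tree fact `kato_selmerCorank_le_order_padicLFunction`, Kato 2004 Thm 18.4), the
`p`-parity theorem (tree fact `selmerCorank_mod_two_eq`, Dokchitser–Dokchitser 2010 Thm 1.4,
inlined as its body), `PinchPrime`, the GZK-cell (Gross–Zagier–Kolyvagin, literature) and the
parity-blind core UBE4 ALONE: Mordell–Weil parity comes from the pinch prime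
(`squeezeUB_parity_of_pinchPrime`), hence PAR; then exactness. So, net of theorems in print and of
its own pinch, the route's UB-hypothesis is exactly "no positive even excess above four rational
points" — first cell `(rank, r_an) = (4, 2)`. CONDITIONAL on the two named facts (hypotheses).
[cite: Kato2004, Thm 18.4] -/
theorem squeezeUBR2_of_pinchPrime_of_ube4
    (hK : ∀ (W : WeierstrassCurve ℚ) [W.IsElliptic] [W.IsGloballyMinimal] (p : ℕ) [Fact p.Prime]
      {N : ℕ} [NeZero N] {f : CuspForm (Gamma0 N) 2},
      kato_selmerCorank_le_order_padicLFunction W p (f := f))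
    (hpp : ∀ (W : WeierstrassCurve ℚ) [W.IsElliptic] [W.IsGloballyMinimal] (p : ℕ) [Fact p.Prime],
      W.selmerCorank p % 2 = W.analyticRank % 2)
    (hP : PinchPrime)
    (hGZK : ∀ (W : WeierstrassCurve ℚ) [W.IsElliptic] [W.IsGloballyMinimal],
      W.analyticRank ≤ 1 → W.mordellWeilRank ≤ W.analyticRank)
    (hUBE : ∀ (W : WeierstrassCurve ℚ) [W.IsElliptic] [W.IsGloballyMinimal],
      4 ≤ W.mordellWeilRank → 2 ≤ W.analyticRank →
        W.mordellWeilRank % 2 = W.analyticRank % 2 → W.mordellWeilRank ≤ W.analyticRank) :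
    SqueezeUBR2 :=
  squeezeUB_iff_threeCells.mpr
    ⟨hGZK, squeezeUB_par_of_parity (squeezeUB_parity_of_pinchPrime hK hpp hP), hUBE⟩

/-- `squeezeUB_iff_threeCells` under the route-LeadingTerm name of the crux (byte-identical
decl). [folklore] -/
theorem squeezeUBR2_iff_threeCells :
    SqueezeUBR2 ↔
      ((∀ (W : WeierstrassCurve ℚ) [W.IsElliptic] [W.IsGloballyMinimal],
          W.analyticRank ≤ 1 → W.mordellWeilRank ≤ W.analyticRank) ∧
        (∀ (W : WeierstrassCurve ℚ) [W.IsElliptic] [W.IsGloballyMinimal],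
          2 ≤ W.analyticRank → W.mordellWeilRank % 2 ≠ W.analyticRank % 2 →
            W.mordellWeilRank ≤ W.analyticRank) ∧
        ∀ (W : WeierstrassCurve ℚ) [W.IsElliptic] [W.IsGloballyMinimal],
          4 ≤ W.mordellWeilRank → 2 ≤ W.analyticRank →
            W.mordellWeilRank % 2 = W.analyticRank % 2 →
              W.mordellWeilRank ≤ W.analyticRank) :=
  squeezeUB_iff_threeCells

/-- `squeezeUB_iff_threeCells` under the route-HigherGrossZagier name of the crux
(byte-identical decl). [folklore] -/
theorem higherGZ_squeezeUB_iff_threeCells :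
    Summit.BirchSwinnertonDyer.BirchSwinnertonDyer.Theses.HigherGrossZagier.SqueezeUB ↔
      ((∀ (W : WeierstrassCurve ℚ) [W.IsElliptic] [W.IsGloballyMinimal],
          W.analyticRank ≤ 1 → W.mordellWeilRank ≤ W.analyticRank) ∧
        (∀ (W : WeierstrassCurve ℚ) [W.IsElliptic] [W.IsGloballyMinimal],
          2 ≤ W.analyticRank → W.mordellWeilRank % 2 ≠ W.analyticRank % 2 →
            W.mordellWeilRank ≤ W.analyticRank) ∧
        ∀ (W : WeierstrassCurve ℚ) [W.IsElliptic] [W.IsGloballyMinimal],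
          4 ≤ W.mordellWeilRank → 2 ≤ W.analyticRank →
            W.mordellWeilRank % 2 = W.analyticRank % 2 →
              W.mordellWeilRank ≤ W.analyticRank) :=
  squeezeUB_iff_threeCells

end Summit.BirchSwinnertonDyer.BirchSwinnertonDyer.Theorems
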